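import Mathlib
import Summits.QuantumFields.BalabanUV.Beta.AnalyticWalkSum216RowData

/-!
# [Balaban1985BackgroundPropagators] (3.138) p. 423 ∕ [Balaban1988RG2Cluster] p. 13 «G̃₃(x) … can be expanded into a
# generalized random walk expansion»: the NEUMANN SERIES and the WOODBURY RECOMBINATION of walk-term families in the
# VOLUME-FREE currency (`RowData`) — constants `ρ^k` per order, `(1 − ρ)⁻¹` for the series, `ρ_G + X·ρ_G²ρ_L` for
# `G − c·G·L·G`, none carrying a volume factor (cell topic `Summits/QuantumFields/BalabanUV/Beta`; row-D4 rider (ρ3),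
# census `BETA/REMAINDER-BETA.md` §10; owner XREAD C-an4-89 (f))

HONEST FRAMING (cell rule).  Discharging `BetaPertH` makes Bałaban's UV stability UNCONDITIONAL — a real
constructive-QFT result; NOT the continuum limit, NOT the Clay problem.  This module discharges NOTHING of `BetaPertH`.
It re-runs `AnalyticWalkSum216Neumann` (orders `piTerm`, Neumann family `neuTerm`, `termSum = (1 − A)⁻¹`) and
`AnalyticWalkSum216Recomb` (the recombined family `recombTerm`, `termSum = G − cGLG`, `woodbury_termSum`) with ROW DATA
(`AnalyticWalkSum216RowData.RowData` = the volume-free hypotheses of an4's `wrs_termSum_sub`) in place of the termwise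
`TermData`: the terms, majorants and summed-operator identities are the siblings' BY NAME; only the CONSTANTS change
currency — order `k` carries `ρ^k` (not `Π ρ_{l t}` summed over all sequences), the series `(1 − ρ)⁻¹`, the
recombination `ρ_G + Xρ_G(ρ_Lρ_G)` with `‖c‖ ≤ X` (x-UNIFORM and VOLUME-FREE).  With this file and its sibling, the
co-owner road's A3-loc output (`UnitLatticeDecoratedChains.wrs_decoratedSum`'s summed majorants, one free coordinate
`s(Δ)` at a time) is the hand-off data for `rowData_recomb` ∕ `woodbury_termSum'` BY NAME.  [folklore]; NO class change
on any GAPS row; NOT summit progress.  Unit `b2b-balaban-beta-an4-g37` (owner of `BINDER-OWNERS.md` row D4); cell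
`GAPS.md` C-an4-90.

CITATION HEADER (lean-in-tree rule).  [13] = T. Bałaban, *Propagators for lattice gauge theories in a background
field*, Commun. Math. Phys. **99**, 389–434 (1985) [Balaban1985BackgroundPropagators], p. 423 [PDF 35] (render
`HOME/b2b-balaban-ref1/pages/1985-cmp99-background-propagators-p035-x2.png`, READ AS IMAGE by this lineage gen 36),
verbatim: *"G₁ = G₀(I − (Δ′_π + Δ^{(2)}_π)G₀)⁻¹ = Σ_{n=0}^∞ G₀((Δ′_π + Δ^{(2)}_π)G₀)ⁿ, (3.138)"*; [II] = T. Bałaban,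
*Renormalization group approach to lattice gauge field theories. II*, Commun. Math. Phys. **116**, 1–22 (1988)
[Balaban1988RG2Cluster], p. 13 [PDF 13]: *"The operator G̃₃(x) has the same properties as G̃₂, especially it can be
expanded into a generalized random walk expansion."*  Nothing printed is asserted; the displays LOCATE the operations.

WHAT IS CERTIFIED HERE (kernel, sorry-free; [folklore]).
§1 `rowData_piTerm` (order `k`: `RowData … (piTerm T k) (piMaj m k) (ρ^k)`), `termSum_piTerm'` (`= (termSum T σ)^k`);
§2 `rowData_neumann` (`RowData … (neuTerm T) (neuMaj m) (1 − ρ)⁻¹` for `ρ < 1`: sigma-summability from `Σ_k ρ^k < ∞`,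
   rows by interchanging the finite row sum with the order sum), `termSum_neumann'` (`= (1 − termSum T σ)⁻¹`, via the
   sibling's entrywise Neumann series `hasSum_pow_apply`), END `wrs_neumann_sub'`;
§3 `rowData_recomb` (`‖c‖ ≤ X` ⟹ `RowData … (recombTerm TG TL c) (recombMaj mG mL X) (ρ_G + X(ρ_G(ρ_Lρ_G)))`),
   `termSum_recomb'`, ENDs `wrs_recomb'`∕`wrs_recomb_sub'`, `woodbury_termSum'` (G₃ IS the summed recombined family);
§4 non-vacuity.
NOT CLAIMED.  Any expansion of Bałaban's operators; U-localisation; (T2)∕(T3).  NOT summit progress.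
PRIOR ART IN THE TREE (searched 2026-08-20): `AnalyticWalkSum216Neumann`∕`Recomb` (gen 37, termwise twins — their
definitions and identities re-used BY NAME); `AnalyticWalkSum216RowData` (the currency).
-/

namespace Summit.QuantumFields.BalabanUV.Beta.AnalyticWalkSum216RowNeumann

open Metric Set Filter Topology
open Literature.MathematicalPhysics.QuantumFieldTheory.Balaban1983to89
open B13PerturbativeStep (WRS WeightHyp)
open Summit.QuantumFields.BalabanUV.Beta.AnalyticWalkSum216 (termSum majSum)
open Summit.QuantumFields.BalabanUV.Beta.AnalyticWalkSum216Algebra (prodTerm prodMaj termSum_reindex)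
open Summit.QuantumFields.BalabanUV.Beta.AnalyticWalkSum216Neumann (piTerm piMaj split piTerm_succ piMaj_succ
  neuTerm neuMaj hasSum_pow_apply)
open Summit.QuantumFields.BalabanUV.Beta.AnalyticWalkSum216Recomb (recombTerm recombMaj woodbury)
open Summit.QuantumFields.BalabanUV.Beta.AnalyticWalkSum216RowData (RowData majSum_reindex termSum_sum' termSum_prod')

noncomputable section

variable {n : Type*} [Fintype n] [DecidableEq n] {W V : Type*} {κ : ℝ} {d : n → n → ℝ} {R : ℝ}

/-! ## §1 Orders -/

section Orders

variable {T : W → ℂ → Matrix n n ℂ} {m : W → n → n → ℝ} {ρ : ℝ}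

omit [DecidableEq n] in
/-- A summed majorant entry is bounded by the row constant (weights `≥ 1`, entries `≥ 0`). [folklore] -/
theorem majSum_le (h : RowData κ d R T m ρ) (hw : WeightHyp κ d) (hR : 0 < R) (i j : n) : majSum m i j ≤ ρ := by
  calc majSum m i j ≤ majSum m i j * Real.exp (κ * d i j) :=
        le_mul_of_one_le_right (h.majSum_nonneg hR i j) (Real.one_le_exp (mul_nonneg hw.κ_nonneg (hw.nonneg i j)))
    _ ≤ ∑ j', majSum m i j' * Real.exp (κ * d i j') :=
        Finset.single_le_sum (f := fun j' => majSum m i j' * Real.exp (κ * d i j'))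
          (fun j' _ => mul_nonneg (h.majSum_nonneg hR i j') (Real.exp_pos _).le) (Finset.mem_univ j)
    _ ≤ ρ := h.hρ i

/-- **ROW DATA FOR EVERY ORDER, constant `ρ^k`**: the `k`-fold product family (the sibling's `prod` + `reindex` along the
splitting, inductively; order `0` = the identity family over the one-point index type). [folklore] -/
theorem rowData_piTerm [Nonempty n] (h : RowData κ d R T m ρ) (hw : WeightHyp κ d) (hR : 0 < R) :
    ∀ k, RowData κ d R (piTerm T k) (piMaj m k) (ρ ^ k)
  | 0 => by
    refine ⟨fun _ i j => differentiableOn_const _, fun _ σ _ i j => ?_, fun i j => .of_finite, fun i => ?_⟩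
    · show ‖(1 : Matrix n n ℂ) i j‖ ≤ (1 : Matrix n n ℝ) i j
      by_cases hij : i = j
      · subst hij; simp
      · simp [Matrix.one_apply_ne hij]
    · have hmaj : ∀ j, majSum (piMaj m 0) i j = (1 : Matrix n n ℝ) i j := fun j => by
        simp only [majSum, piMaj]
        rw [tsum_fintype, Fintype.sum_unique]
      rw [pow_zero, Finset.sum_eq_single i (fun j _ hj => by rw [hmaj, Matrix.one_apply_ne (Ne.symm hj), zero_mul])
        (fun h => (h (Finset.mem_univ i)).elim), hmaj, Matrix.one_apply_eq, hw.zero i, mul_zero, Real.exp_zero, one_mul]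
  | k + 1 => by
    rw [piTerm_succ, piMaj_succ, pow_succ']
    exact (h.prod (rowData_piTerm h hw hR k) hw hR).reindex (split W k)

/-- `termSum (piTerm T k) σ = (termSum T σ)^k` under row data. [cite: Balaban1985BackgroundPropagators, p.422 after (3.131)] -/
theorem termSum_piTerm' [Nonempty n] (h : RowData κ d R T m ρ) (hw : WeightHyp κ d) (hR : 0 < R) {σ : ℂ}
    (hσ : σ ∈ ball (0 : ℂ) R) : ∀ k, termSum (piTerm T k) σ = termSum T σ ^ k
  | 0 => by
    ext i j
    simp only [termSum, piTerm, pow_zero]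
    rw [tsum_fintype, Fintype.sum_unique]
  | k + 1 => by
    rw [piTerm_succ, termSum_reindex (prodTerm T (piTerm T k)) (split W k) σ,
      termSum_prod' h (rowData_piTerm h hw hR k) hσ, termSum_piTerm' h hw hR hσ k, pow_succ']

end Orders

/-! ## §2 The Neumann family -/

section Neumann

variable {T : W → ℂ → Matrix n n ℂ} {m : W → n → n → ℝ} {ρ : ℝ}

/-- **THE NEUMANN SERIES OF A WALK-TERM FAMILY, VOLUME-FREE**: row data for `neuTerm T` with majorants `neuMaj m` and
constant `(1 − ρ)⁻¹`, for `ρ < 1`. [cite: Balaban1985BackgroundPropagators, (3.138) p.423] -/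
theorem rowData_neumann [Nonempty n] (h : RowData κ d R T m ρ) (hw : WeightHyp κ d) (hR : 0 < R) (hρ1 : ρ < 1) :
    RowData κ d R (neuTerm T) (neuMaj m) (1 - ρ)⁻¹ := by
  have hP : ∀ k, RowData κ d R (piTerm T k) (piMaj m k) (ρ ^ k) := rowData_piTerm h hw hR
  have hρ0 : 0 ≤ ρ := h.ρ_nonneg hR
  have hgeo : Summable fun k : ℕ => ρ ^ k := summable_geometric_of_lt_one hρ0 hρ1
  -- per order: nonnegativity, entrywise summability, the entry bound `majSum (piMaj m k) i j ≤ ρ^k`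
  have hnn : ∀ (x : Σ k, Fin k → W) (i j : n), 0 ≤ piMaj m x.1 x.2 i j := fun x i j => (hP x.1).m_nonneg hR x.2 i j
  have hfib : ∀ (k : ℕ) (i j : n), Summable fun l : Fin k → W => piMaj m k l i j := fun k i j => (hP k).hsum i j
  have hfib0 : ∀ (k : ℕ) (i j : n), 0 ≤ majSum (piMaj m k) i j := fun k i j => (hP k).majSum_nonneg hR i j
  have hfible : ∀ (k : ℕ) (i j : n), majSum (piMaj m k) i j ≤ ρ ^ k := fun k i j => majSum_le (hP k) hw hR i j
  have hsk : ∀ i j, Summable fun k => majSum (piMaj m k) i j := fun i j =>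
    .of_nonneg_of_le (fun k => hfib0 k i j) (fun k => hfible k i j) hgeo
  have hsig : ∀ i j, Summable fun x : Σ k, Fin k → W => piMaj m x.1 x.2 i j := fun i j =>
    (summable_sigma_of_nonneg fun x => hnn x i j).2 ⟨fun k => hfib k i j, hsk i j⟩
  refine ⟨fun x => (hP x.1).ha x.2, fun x => (hP x.1).hm x.2, hsig, fun i => ?_⟩
  -- rows: Σ_j (Σ'_k majSum (piMaj m k) i j) e^{κd} = Σ'_k Σ_j … ≤ Σ'_k ρ^k = (1 − ρ)⁻¹
  have hmaj : ∀ j, majSum (neuMaj m) i j = ∑' k, majSum (piMaj m k) i j := fun j =>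
    (hsig i j).tsum_sigma' (fun k => hfib k i j)
  calc ∑ j, majSum (neuMaj m) i j * Real.exp (κ * d i j)
      = ∑ j, (∑' k, majSum (piMaj m k) i j) * Real.exp (κ * d i j) :=
        Finset.sum_congr rfl fun j _ => by rw [hmaj j]
    _ = ∑ j, ∑' k, majSum (piMaj m k) i j * Real.exp (κ * d i j) :=
        Finset.sum_congr rfl fun j _ => (Summable.tsum_mul_right _ (hsk i j)).symm
    _ = ∑' k, ∑ j, majSum (piMaj m k) i j * Real.exp (κ * d i j) :=
        (Summable.tsum_finsetSum (fun j _ => (hsk i j).mul_right _)).symm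
    _ ≤ ∑' k, ρ ^ k :=
        Summable.tsum_le_tsum (fun k => (hP k).hρ i) (summable_sum fun j _ => (hsk i j).mul_right _) hgeo
    _ = (1 - ρ)⁻¹ := tsum_geometric_of_lt_one hρ0 hρ1

/-- **`termSum` OF THE NEUMANN FAMILY IS THE INVERSE** under row data: `termSum (neuTerm T) σ = (1 − termSum T σ)⁻¹`
(the sibling's `hasSum_pow_apply` on the complex summed operator, whose `WRS` bound `ρ < 1` row data supply).
[cite: Balaban1985BackgroundPropagators, (3.138) p.423] -/
theorem termSum_neumann' [Nonempty n] (h : RowData κ d R T m ρ) (hw : WeightHyp κ d) (hR : 0 < R) (hρ1 : ρ < 1)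
    {σ : ℂ} (hσ : σ ∈ ball (0 : ℂ) R) : termSum (neuTerm T) σ = (1 - termSum T σ)⁻¹ := by
  have hP : ∀ k, RowData κ d R (piTerm T k) (piMaj m k) (ρ ^ k) := rowData_piTerm h hw hR
  have hN : RowData κ d R (neuTerm T) (neuMaj m) (1 - ρ)⁻¹ := rowData_neumann h hw hR hρ1
  ext i j
  have hfib : ∀ k, Summable fun l : Fin k → W => piTerm T k l σ i j := fun k => (hP k).summable hσ i j
  have htot : Summable fun x : Σ k, Fin k → W => piTerm T x.1 x.2 σ i j := hN.summable hσ i j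
  have hk : ∀ k, ∑' l : Fin k → W, piTerm T k l σ i j = (termSum T σ ^ k) i j := fun k => by
    have e := congrFun (congrFun (termSum_piTerm' h hw hR hσ k) i) j
    simpa only [termSum] using e
  change ∑' x : Σ k, Fin k → W, piTerm T x.1 x.2 σ i j = _
  rw [htot.tsum_sigma' hfib, tsum_congr hk]
  exact (hasSum_pow_apply hw (h.wrs_termSum hσ) hρ1 i j).tsum_eq

/-- **END, volume-free**: `WRS κ d ((1 − A σ)⁻¹ − (1 − A 0)⁻¹) (2(1 − ρ)⁻¹/R·‖σ‖)`, `A = termSum T`.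
[cite: Balaban1988RG2Cluster, (2.16)–(2.17) p.16] -/
theorem wrs_neumann_sub' [Nonempty n] (h : RowData κ d R T m ρ) (hw : WeightHyp κ d) (hR : 0 < R) (hρ1 : ρ < 1)
    {σ : ℂ} (hσ : σ ∈ ball (0 : ℂ) R) :
    WRS κ d ((1 - termSum T σ)⁻¹ - (1 - termSum T 0)⁻¹) (2 * (1 - ρ)⁻¹ / R * ‖σ‖) := by
  rw [← termSum_neumann' h hw hR hρ1 hσ, ← termSum_neumann' h hw hR hρ1 (mem_ball_self hR)]
  exact (rowData_neumann h hw hR hρ1).wrs_termSum_sub hR hσ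

end Neumann

/-! ## §3 The Woodbury recombination -/

section Recomb

variable {TG : W → ℂ → Matrix n n ℂ} {mG : W → n → n → ℝ} {ρG : ℝ}
  {TL : V → ℂ → Matrix n n ℂ} {mL : V → n → n → ℝ} {ρL : ℝ}

omit [DecidableEq n] in
/-- **x-UNIFORM, VOLUME-FREE ROW DATA OF THE RECOMBINED FAMILY `G − c·G·L·G`**: constant `ρ_G + X·(ρ_G(ρ_Lρ_G))` for
`‖c‖ ≤ X`. [folklore] -/
theorem rowData_recomb [Nonempty n] (hG : RowData κ d R TG mG ρG) (hL : RowData κ d R TL mL ρL)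
    (hw : WeightHyp κ d) (hR : 0 < R) {c : ℂ} {X : ℝ} (hc : ‖c‖ ≤ X) :
    RowData κ d R (recombTerm TG TL c) (recombMaj mG mL X) (ρG + X * (ρG * (ρL * ρG))) :=
  hG.sum ((hG.prod (hL.prod hG hw hR) hw hR).smul (show ‖-c‖ ≤ X by rwa [norm_neg]))

omit [DecidableEq n] in
/-- `termSum (recombTerm TG TL c) σ = G − c·G·(L·G)` under row data. [folklore] -/
theorem termSum_recomb' [Nonempty n] (hG : RowData κ d R TG mG ρG) (hL : RowData κ d R TL mL ρL)
    (hw : WeightHyp κ d) (hR : 0 < R) (c : ℂ) {σ : ℂ} (hσ : σ ∈ ball (0 : ℂ) R) :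
    termSum (recombTerm TG TL c) σ =
      termSum TG σ - c • (termSum TG σ * (termSum TL σ * termSum TG σ)) := by
  have hLG := hL.prod hG hw hR
  have h3 := (hG.prod hLG hw hR).smul (show ‖-c‖ ≤ ‖c‖ by rw [norm_neg])
  rw [recombTerm, termSum_sum' hG h3 hσ, AnalyticWalkSum216Algebra.termSum_smul, termSum_prod' hG hLG hσ,
    termSum_prod' hL hG hσ, neg_smul, sub_eq_add_neg]

omit [DecidableEq n] in
/-- **END at every point, x-uniform and volume-free.** [cite: Balaban1988RG2Cluster, (2.16) p.16] -/
theorem wrs_recomb' [Nonempty n] (hG : RowData κ d R TG mG ρG) (hL : RowData κ d R TL mL ρL)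
    (hw : WeightHyp κ d) (hR : 0 < R) {c : ℂ} {X : ℝ} (hc : ‖c‖ ≤ X) {σ : ℂ} (hσ : σ ∈ ball (0 : ℂ) R) :
    WRS κ d (termSum (recombTerm TG TL c) σ) (ρG + X * (ρG * (ρL * ρG))) :=
  (rowData_recomb hG hL hw hR hc).wrs_termSum hσ

omit [DecidableEq n] in
/-- **END for the difference, x-uniform and volume-free** — rider (ρ3) in the currency (T1) consumes.
[cite: Balaban1988RG2Cluster, (2.16)–(2.17) p.16] -/
theorem wrs_recomb_sub' [Nonempty n] (hG : RowData κ d R TG mG ρG) (hL : RowData κ d R TL mL ρL)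
    (hw : WeightHyp κ d) (hR : 0 < R) {c : ℂ} {X : ℝ} (hc : ‖c‖ ≤ X) {σ : ℂ} (hσ : σ ∈ ball (0 : ℂ) R) :
    WRS κ d (termSum (recombTerm TG TL c) σ - termSum (recombTerm TG TL c) 0)
      (2 * (ρG + X * (ρG * (ρL * ρG))) / R * ‖σ‖) :=
  (rowData_recomb hG hL hw hR hc).wrs_termSum_sub hR hσ

/-- **`G₃ = (G⁻¹ + P(c•1)Q)⁻¹` IS THE SUMMED RECOMBINED FAMILY** under row data (the sibling's `woodbury`).
[cite: Balaban1988RG2Cluster, p.13 after (2.7)] -/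
theorem woodbury_termSum' [Nonempty n] {Y : Type*} [Fintype Y] [DecidableEq Y]
    (hG : RowData κ d R TG mG ρG) (hL : RowData κ d R TL mL ρL) (hw : WeightHyp κ d) (hR : 0 < R)
    (P : Matrix n Y ℂ) (Q : Matrix Y n ℂ) {c : ℂ} (hc : c ≠ 0) {σ : ℂ} (hσ : σ ∈ ball (0 : ℂ) R)
    (hGu : IsUnit (termSum TG σ)) (hK : IsUnit (1 + c • (Q * termSum TG σ * P)))
    (hTL : termSum TL σ = P * (1 + c • (Q * termSum TG σ * P))⁻¹ * Q) :
    ((termSum TG σ)⁻¹ + P * (c • (1 : Matrix Y Y ℂ)) * Q)⁻¹ = termSum (recombTerm TG TL c) σ := by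
  rw [termSum_recomb' hG hL hw hR c hσ, woodbury (termSum TG σ) P Q hc hGu hK, hTL]
  simp only [Matrix.mul_assoc]

end Recomb

/-! ## §4 Non-vacuity -/

/-- The hypotheses of `wrs_recomb_sub'` are jointly satisfiable (the sibling's one-site example, `X = 2`, `ρ = 1`).
[folklore] -/
example : WRS (n := Unit) 0 (fun _ _ => 0)
    (termSum (recombTerm (fun (_ : Unit) (σ : ℂ) => fun (_ _ : Unit) => σ)
        (fun (_ : Unit) (σ : ℂ) => fun (_ _ : Unit) => σ) (2 : ℂ)) (1 / 2) -
      termSum (recombTerm (fun (_ : Unit) (σ : ℂ) => fun (_ _ : Unit) => σ)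
        (fun (_ : Unit) (σ : ℂ) => fun (_ _ : Unit) => σ) (2 : ℂ)) 0)
    (2 * (1 + 2 * (1 * (1 * 1))) / 1 * ‖(1 / 2 : ℂ)‖) := by
  have hw : WeightHyp (n := Unit) 0 (fun _ _ => 0) := ⟨le_rfl, fun _ => rfl, fun _ _ => le_rfl, fun _ _ _ => by simp⟩
  have h := AnalyticWalkSum216RowData.rowData_example
  refine wrs_recomb_sub' h h hw one_pos (X := 2) (by simp) ?_
  rw [mem_ball_zero_iff]; norm_num

end

end Summit.QuantumFields.BalabanUV.Beta.AnalyticWalkSum216RowNeumann
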